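import Summits.QuantumAdvantage.QuantumAdvantage.Theses.StickelbergerGrid
import Literature.Computability.Cryptography.VanDamSeroussiGaussSums
import Literature.Computability.QuantumComplexity.CWrapAssembly
import Literature.Computability.Cryptography.QubitRegisterCliffordTProofs
import HarnessLib

/-!
# Line `birth` — BC3 skeleton for the crux `SectorMembershipOfGrid` (stmt-QuantumAdvantage-17349)

Route `StickelbergerGrid` (route-QuantumAdvantage-StickelbergerGrid; deciding theorem
`closes (hX : SectorHardness) (hG : GaussPowerFBQP) (hP : SectorMembershipOfGrid) : QuantumAdvantage`),
crux #3 (rank 3, "THE POINT + THE CUT"):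

  `SectorMembershipOfGrid := GaussPowerFBQP → ∀ C, E₄.toLanguage L_C ∈ BQP`

where `E₄ = bin × (bin × (bin × bin))` (nested `boolPair` of binary naturals) and `L_C` is the SECTOR SET
of tuples `(p, ℓ, r, k)` with `p, ℓ` prime, `ℓ` odd, `ℓ ∣ p − 1`, `ℓ ≤ (log₂ p)^C`, `r < p` of exact
order `ℓ` (`r^ℓ ≡ 1 ≢ r`), `k < ℓ`, and `⌊ℓ (arg S + π) / 2π⌋ = k` for the Gauss sum
`S = S(p, ℓ, r) = Σ_{1 ≤ x ≤ p−1} Σ_{j<ℓ} [r^j ≡ x^{(p−1)/ℓ}] e(j/ℓ + x/p) = g(χ_r)` of the order-`ℓ`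
character `χ_r` pinned by `r` (`χ_r(x) = ζ_ℓ^j iff x^{(p−1)/ℓ} ≡ r^j`).  Write `ADM_C(p, ℓ, r, k)` for the
nine admissibility conjuncts, `GRID(a)` for "`a ∈ ℤ^{ℓ−1}` is the coefficient vector of
`S^ℓ = Σ_{j<ℓ−1} a_j ζ_ℓ^j ∈ ℤ[ζ_ℓ]`" (verbatim the conclusion of `GaussPowerFBQP`), and `ANG(m)` for
"`2πm/(64ℓ)` is within `2π/(64ℓ)` of `arg S` (mod `2π`)", i.e. `|arg (S · e^{−2πi m/(64ℓ)})| ≤ 2π/(64ℓ)`.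

## The line (the route's own informal plan for this crux, cut along the quantum / plumbing / arithmetic seams)

* `stub_point` — THE POINT (QUANTUM; van Dam–Seroussi 2002 §4 Thm 1 + Kitaev phase estimation, precision
  UNIFORM in `ℓ`; size XL).  For every `C` there is ONE `P`-uniform oracle-free Clifford+T family which, on
  every admissible input `u = E₄(p, ℓ, r, k)` (no requirement on other inputs), outputs a self-delimited grid
  point `⟨bin m, z⟩`, `m < 64ℓ`, with `ANG(m)`, with probability `≥ 2/3 + δ` for some fixed `δ > 0` (slack
  form: the hypothesis shape of `OracleWrap.isQSolvable_of_slack`; phase estimation gives any constant).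
  Ingredients: `|χ_r⟩ = (p−1)^{−1/2} Σ_x χ_r(x)|x⟩` prepared WITHOUT a primitive root (the index `j` of
  `x^{(p−1)/ℓ}` in `⟨r⟩` is a brute-force search over `j < ℓ ≤ (log₂ p)^C`); `|χ_r⟩` is an eigenvector of
  `D_{χ_r²} ∘ F_p` with eigenvalue `S/√p` (vDS Thm 1); phase estimation to `± 2π/(64ℓ)` with `ℓ` read off
  the tape — for fixed `C` the cost `O(ℓ · polylog p)` is polynomial in `|u|`.  The tree's named fact
  `VanDamSeroussi2002_gaussSumPhase_qsolvable` is the same theorem at every FIXED precision `t` and for the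
  `(g, a)` presentation of `χ`; this stub is its precision-uniform, `r`-presented form (the grounder's
  "wanted" fact).  Why it might fail: only AS TYPED (uniform approximate `F_p` / Kitaev shift block with a
  proved operator-norm error; eigenstate preparation for the `r`-presentation) — mathematically safe.
* `stub_join` — THE GRID JOINS THE POINT (COMPLEXITY PLUMBING, `BQP^BQP = BQP` for search problems; size
  M–L).  Assuming the grid `GaussPowerFBQP` (the route's crux #2, an `FBQP` function printing the integer
  vector `a` with `GRID(a)`) and `stub_point`, for every `C` the JOINT search problem "on admissible `u`
  output `⟨listBool a, ⟨bin m, z⟩⟩` with `GRID(a) ∧ m < 64ℓ ∧ ANG(m)`" is `IsQSolvable` (one family, error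
  `≤ 1/3`).  Tools in the tree: the bit-graph language of an `FBQP` function is in `BQP`
  (`bitGraph_mem_BQP`, canonicaliser = the self-delimiting `listBool` parse), a pre-processor in `FP^A`
  fetching `a` bit by bit, then `OracleWrap.isQSolvable_of_slack` / `isQSolvable_of_generated_oracle_circuits`
  (the slack `δ` of `stub_point` pays for the union bound), or `Juxt.*` (families side by side) with
  `BQPMajorityAmplification` for the function half.  Why it might fail: not mathematically; the
  pre-processor-with-oracle bookkeeping (`FPRel`) for a list-valued function is new.
* `stub_cut` — THE CUT (CLASSICAL EXACT DECISION in `FP`; size L).  For every `C` ONE polynomial-time `D`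
  which (a) answers `[false]` on `⟨u, w⟩` whenever `u` is not the canonical code of an admissible tuple
  (decode/re-encode check; AKS for `p` and `ℓ` — `PRIMES_mem_P_holds`, `primeFn_mem_FP`; modexp; `Nat.log`),
  and (b) on `⟨E₄(p,ℓ,r,k), ⟨listBool a, ⟨bin m, z⟩⟩⟩` with `GRID(a)`, `m < 64ℓ`, `ANG(m)` returns EXACTLY
  `[decide (⌊ℓ(arg S + π)/2π⌋ = k)]`.  On paper (route text; refuter-verified at birth): `arg S = (Θ + 2πn)/ℓ`
  with `Θ = Arg S^ℓ ∈ (−π, π]`, so `⌊ℓ(arg S + π)/2π⌋ = n + (ℓ−1)/2` whenever `Θ ≠ π` (`S^ℓ ∉ ℝ`: support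
  item `GaussPowerNotReal`); the candidates `(Θ + 2πn)/ℓ` are `2π/ℓ` apart and `ANG(m)` pins `n` from a
  coarse value of `Θ` — except near the cut `Θ ≈ ±π`, where the label is decided by the SIGN of
  `Im S^ℓ = Σ_j a_j sin(2πj/ℓ)`, an exact sign test on an algebraic integer of degree `≤ ℓ−1` with conjugates
  `≤ p^{ℓ/2}` (Liouville-type separation `|Im σ(S^ℓ)| ≥ (2p^{ℓ/2})^{−(ℓ−2)}`, `poly(ℓ log p)` bits).
  Why it might fail: not mathematically; multiprecision evaluation of `sin(2πj/ℓ)` / the sign test inside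
  the tree's `FP` (Turing-machine) model is new bookkeeping (cf. `CEstFP.lean`, `ConvergentNumeratorsFP.lean`).
* Composition `SectorMembershipOfGrid_of` (sorry-free, kernel-checked): Bernstein–Vazirani §8 "P-computation
  is free inside BQP" — wrap the joint search family (`stub_join` fed with the grid hypothesis of the crux and
  `stub_point`) with the decoder of `stub_cut` (`isQSolvable_classicalWrap_holds`, pre-processor `id`), observe
  that on EVERY input the wrapped family writes the indicator bit of `E₄.toLanguage L_C` first (on admissible
  inputs by (b); off them by (a), where membership is false because `E₄.encode` is canonical), and read wire
  `0` (`mem_BQP_of_isQSolvable_bit` with `QCircuit.outputPMF_apply_holds`, `cliffordT_isUnitary_holds`).  The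
  generic half `toLanguage_mem_BQP_of_search_decode` is stated for an arbitrary Boolean encoding.

Disproof used: none exists for this crux (`ledger crux ls stmt-QuantumAdvantage-17349`: no workfiles, no
`Disproof.lean`, no `Theorems/…/Negative` lemmas; `ledger negatives --problem QuantumAdvantage` lists six
refuted statements, none on this route).  `sorry` occurs ONLY in the three `stub_*` theorems;
`SectorMembershipOfGrid_of` takes the three stub statements (the `Goal.stub_*` abbreviations, restated
verbatim by the stubs) as hypotheses and concludes the crux decl BY NAME; the `example` at the end checks
that the registered stubs feed it.
-/

set_option linter.dupNamespace false
set_option linter.unusedVariables false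

namespace Summit.QuantumAdvantage.QuantumAdvantage.Cruxes.SectorMembershipOfGrid.Birth

open _root_.Computability Literature.Computability.Complexity Literature.Computability.Cryptography
open Summit.QuantumAdvantage.QuantumAdvantage.Theses.StickelbergerGrid (GaussPowerFBQP SectorMembershipOfGrid)

/-! ### The three stub statements (named, so that the composition can take them as hypotheses) -/

namespace Goal

/-- Statement of `stub_point`: precision-uniform van Dam–Seroussi phase point for `S(p, ℓ, r)` on the grid
`2πℤ/(64ℓ)`, self-delimited output, slack form (success `≥ 2/3 + δ`), one family per exponent `C`. -/
abbrev stub_point : Prop :=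
  ∀ C : ℕ, ∃ F : QCircuitFamily cliffordT, F.IsOracleFree ∧ F.IsUniform ∧ ∃ δ : ℝ, 0 < δ ∧ ∀ u : List Bool,
    2 / 3 + δ ≤ F.kernelProb 0 u {y | ∀ p ℓ r k : ℕ, p.Prime ∧ ℓ.Prime ∧ Odd ℓ ∧ ℓ ∣ p - 1 ∧ ℓ ≤ Nat.log 2 p ^
    C ∧ r < p ∧ r ^ ℓ % p = 1 ∧ r % p ≠ 1 ∧ k < ℓ → u = (Computability.encodingNatBool.pairBool
    (Computability.encodingNatBool.pairBool (Computability.encodingNatBool.pairBool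
    Computability.encodingNatBool))).encode (p, (ℓ, (r, k))) → ∃ (m : ℕ) (z : List Bool), m < 64 * ℓ ∧
    |Complex.arg ((∑ x ∈ Finset.Icc 1 (p - 1), ∑ j ∈ Finset.range ℓ, if r ^ j % p = x ^ ((p - 1) / ℓ) % p then
    Complex.exp (2 * Real.pi * Complex.I * ((j : ℂ) / (ℓ : ℂ) + (x : ℂ) / (p : ℂ))) else 0) * Complex.exp (-(2
    * Real.pi * Complex.I * (m : ℂ) / (64 * (ℓ : ℂ)))))| ≤ 2 * Real.pi / (64 * (ℓ : ℝ)) ∧ y = boolPair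
    (encodeNat m) z}

/-- Statement of `stub_join`: given the grid (`GaussPowerFBQP`) and the point (`stub_point`), the joint search
"exact `S^ℓ` AND an accurate grid point" is `IsQSolvable` for every `C`. -/
abbrev stub_join : Prop :=
  GaussPowerFBQP → (∀ C : ℕ, ∃ F : QCircuitFamily cliffordT, F.IsOracleFree ∧ F.IsUniform ∧ ∃ δ : ℝ, 0 < δ ∧
    ∀ u : List Bool, 2 / 3 + δ ≤ F.kernelProb 0 u {y | ∀ p ℓ r k : ℕ, p.Prime ∧ ℓ.Prime ∧ Odd ℓ ∧ ℓ ∣ p - 1 ∧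
    ℓ ≤ Nat.log 2 p ^ C ∧ r < p ∧ r ^ ℓ % p = 1 ∧ r % p ≠ 1 ∧ k < ℓ → u =
    (Computability.encodingNatBool.pairBool (Computability.encodingNatBool.pairBool
    (Computability.encodingNatBool.pairBool Computability.encodingNatBool))).encode (p, (ℓ, (r, k))) → ∃ (m :
    ℕ) (z : List Bool), m < 64 * ℓ ∧ |Complex.arg ((∑ x ∈ Finset.Icc 1 (p - 1), ∑ j ∈ Finset.range ℓ, if r ^ j
    % p = x ^ ((p - 1) / ℓ) % p then Complex.exp (2 * Real.pi * Complex.I * ((j : ℂ) / (ℓ : ℂ) + (x : ℂ) / (p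
    : ℂ))) else 0) * Complex.exp (-(2 * Real.pi * Complex.I * (m : ℂ) / (64 * (ℓ : ℂ)))))| ≤ 2 * Real.pi / (64
    * (ℓ : ℝ)) ∧ y = boolPair (encodeNat m) z}) → ∀ C : ℕ, IsQSolvable fun u : List Bool => {y | ∀ p ℓ r k :
    ℕ, p.Prime ∧ ℓ.Prime ∧ Odd ℓ ∧ ℓ ∣ p - 1 ∧ ℓ ≤ Nat.log 2 p ^ C ∧ r < p ∧ r ^ ℓ % p = 1 ∧ r % p ≠ 1 ∧ k < ℓ
    → u = (Computability.encodingNatBool.pairBool (Computability.encodingNatBool.pairBool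
    (Computability.encodingNatBool.pairBool Computability.encodingNatBool))).encode (p, (ℓ, (r, k))) → ∃ (a :
    List ℤ) (m : ℕ) (z : List Bool), (a.length = ℓ - 1 ∧ (∑ j ∈ Finset.range (ℓ - 1), ((a.getD j 0 : ℤ) : ℂ) *
    Complex.exp (2 * Real.pi * Complex.I * (j : ℂ) / (ℓ : ℂ))) = (∑ x ∈ Finset.Icc 1 (p - 1), ∑ j ∈
    Finset.range ℓ, if r ^ j % p = x ^ ((p - 1) / ℓ) % p then Complex.exp (2 * Real.pi * Complex.I * ((j : ℂ)
    / (ℓ : ℂ) + (x : ℂ) / (p : ℂ))) else 0) ^ ℓ) ∧ m < 64 * ℓ ∧ |Complex.arg ((∑ x ∈ Finset.Icc 1 (p - 1), ∑ j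
    ∈ Finset.range ℓ, if r ^ j % p = x ^ ((p - 1) / ℓ) % p then Complex.exp (2 * Real.pi * Complex.I * ((j :
    ℂ) / (ℓ : ℂ) + (x : ℂ) / (p : ℂ))) else 0) * Complex.exp (-(2 * Real.pi * Complex.I * (m : ℂ) / (64 * (ℓ :
    ℂ)))))| ≤ 2 * Real.pi / (64 * (ℓ : ℝ)) ∧ y = boolPair
    (Literature.Computability.Complexity.encodingIntBool.listBool.encode a) (boolPair (encodeNat m) z)}

/-- Statement of `stub_cut`: the exact classical decision wrap, one `FP` function per `C`, with input
validation (a) and the exact sector bit (b) from the grid value and the approximate angle. -/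
abbrev stub_cut : Prop :=
  ∀ C : ℕ, ∃ D : List Bool → List Bool, D ∈ FP ∧ (∀ u w : List Bool, (∀ p ℓ r k : ℕ, p.Prime ∧ ℓ.Prime ∧ Odd
    ℓ ∧ ℓ ∣ p - 1 ∧ ℓ ≤ Nat.log 2 p ^ C ∧ r < p ∧ r ^ ℓ % p = 1 ∧ r % p ≠ 1 ∧ k < ℓ → u ≠
    (Computability.encodingNatBool.pairBool (Computability.encodingNatBool.pairBool
    (Computability.encodingNatBool.pairBool Computability.encodingNatBool))).encode (p, (ℓ, (r, k)))) → D
    (boolPair u w) = [false]) ∧ (∀ (p ℓ r k m : ℕ) (a : List ℤ) (z : List Bool), p.Prime ∧ ℓ.Prime ∧ Odd ℓ ∧ ℓ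
    ∣ p - 1 ∧ ℓ ≤ Nat.log 2 p ^ C ∧ r < p ∧ r ^ ℓ % p = 1 ∧ r % p ≠ 1 ∧ k < ℓ → (a.length = ℓ - 1 ∧ (∑ j ∈
    Finset.range (ℓ - 1), ((a.getD j 0 : ℤ) : ℂ) * Complex.exp (2 * Real.pi * Complex.I * (j : ℂ) / (ℓ : ℂ)))
    = (∑ x ∈ Finset.Icc 1 (p - 1), ∑ j ∈ Finset.range ℓ, if r ^ j % p = x ^ ((p - 1) / ℓ) % p then Complex.exp
    (2 * Real.pi * Complex.I * ((j : ℂ) / (ℓ : ℂ) + (x : ℂ) / (p : ℂ))) else 0) ^ ℓ) → m < 64 * ℓ →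
    |Complex.arg ((∑ x ∈ Finset.Icc 1 (p - 1), ∑ j ∈ Finset.range ℓ, if r ^ j % p = x ^ ((p - 1) / ℓ) % p then
    Complex.exp (2 * Real.pi * Complex.I * ((j : ℂ) / (ℓ : ℂ) + (x : ℂ) / (p : ℂ))) else 0) * Complex.exp (-(2
    * Real.pi * Complex.I * (m : ℂ) / (64 * (ℓ : ℂ)))))| ≤ 2 * Real.pi / (64 * (ℓ : ℝ)) → D (boolPair
    ((Computability.encodingNatBool.pairBool (Computability.encodingNatBool.pairBool
    (Computability.encodingNatBool.pairBool Computability.encodingNatBool))).encode (p, (ℓ, (r, k))))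
    (boolPair (Literature.Computability.Complexity.encodingIntBool.listBool.encode a) (boolPair (encodeNat m)
    z))) = [decide (Int.floor ((ℓ : ℝ) * (Complex.arg (∑ x ∈ Finset.Icc 1 (p - 1), ∑ j ∈ Finset.range ℓ, if r
    ^ j % p = x ^ ((p - 1) / ℓ) % p then Complex.exp (2 * Real.pi * Complex.I * ((j : ℂ) / (ℓ : ℂ) + (x : ℂ) /
    (p : ℂ))) else 0) + Real.pi) / (2 * Real.pi)) = (k : ℤ))])

end Goal

/-! ### The stubs (registered; `sorry` lives only here) -/

/-- **stub_point** (quantum; vanDamSeroussi2002 §4 Thm 1 for `χ_r`, precision uniform in `ℓ ≤ (log₂ p)^C`,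
Kitaev1995 phase estimation; XL). -/
theorem stub_point : ∀ C : ℕ, ∃ F : QCircuitFamily cliffordT, F.IsOracleFree ∧ F.IsUniform ∧ ∃ δ : ℝ, 0 < δ ∧ ∀ u : List Bool, 2 / 3 + δ ≤ F.kernelProb 0 u {y | ∀ p ℓ r k : ℕ, p.Prime ∧ ℓ.Prime ∧ Odd ℓ ∧ ℓ ∣ p - 1 ∧ ℓ ≤ Nat.log 2 p ^ C ∧ r < p ∧ r ^ ℓ % p = 1 ∧ r % p ≠ 1 ∧ k < ℓ → u = (Computability.encodingNatBool.pairBool (Computability.encodingNatBool.pairBool (Computability.encodingNatBool.pairBool Computability.encodingNatBool))).encode (p, (ℓ, (r, k))) → ∃ (m : ℕ) (z : List Bool), m < 64 * ℓ ∧ |Complex.arg ((∑ x ∈ Finset.Icc 1 (p - 1), ∑ j ∈ Finset.range ℓ, if r ^ j % p = x ^ ((p - 1) / ℓ) % p then Complex.exp (2 * Real.pi * Complex.I * ((j : ℂ) / (ℓ : ℂ) + (x : ℂ) / (p : ℂ))) else 0) * Complex.exp (-(2 * Real.pi * Complex.I * (m : ℂ) / (64 * (ℓ : ℂ)))))| ≤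 2 * Real.pi / (64 * (ℓ : ℝ)) ∧ y = boolPair (encodeNat m) z} := by
  sorry

/-- **stub_join** (complexity plumbing; `BQP^BQP = BQP` for search problems: `bitGraph_mem_BQP`,
`OracleWrap.isQSolvable_of_slack` / `isQSolvable_of_generated_oracle_circuits`; M–L). -/
theorem stub_join : GaussPowerFBQP → (∀ C : ℕ, ∃ F : QCircuitFamily cliffordT, F.IsOracleFree ∧ F.IsUniform ∧ ∃ δ : ℝ, 0 < δ ∧ ∀ u : List Bool, 2 / 3 + δ ≤ F.kernelProb 0 u {y | ∀ p ℓ r k : ℕ, p.Prime ∧ ℓ.Prime ∧ Odd ℓ ∧ ℓ ∣ p - 1 ∧ ℓ ≤ Nat.log 2 p ^ C ∧ r < p ∧ r ^ ℓ % p = 1 ∧ r % p ≠ 1 ∧ k < ℓ → u = (Computability.encodingNatBool.pairBool (Computability.encodingNatBool.pairBool (Computability.encodingNatBool.pairBool Computability.encodingNatBool))).encode (p, (ℓ, (r, k))) → ∃ (m : ℕ) (z : List Bool), m < 64 * ℓ ∧ |Complex.arg ((∑ x ∈ Finset.Icc 1 (p - 1), ∑ j ∈ Finset.range ℓ, if r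 ^ j % p = x ^ ((p - 1) / ℓ) % p then Complex.exp (2 * Real.pi * Complex.I * ((j : ℂ) / (ℓ : ℂ) + (x : ℂ) / (p : ℂ))) else 0) * Complex.exp (-(2 * Real.pi * Complex.I * (m : ℂ) / (64 * (ℓ : ℂ)))))| ≤ 2 * Real.pi / (64 * (ℓ : ℝ)) ∧ y = boolPair (encodeNat m) z}) → ∀ C : ℕ, IsQSolvable fun u : List Bool => {y | ∀ p ℓ r k : ℕ, p.Prime ∧ ℓ.Prime ∧ Odd ℓ ∧ ℓ ∣ p - 1 ∧ ℓ ≤ Nat.log 2 p ^ C ∧ r < p ∧ r ^ ℓ % p = 1 ∧ r % p ≠ 1 ∧ k < ℓ → u = (Computability.encodingNatBool.pairBool (Computability.encodingNatBool.pairBool (Computability.encodingNatBool.pairBool Computability.encodingNatBool))).encode (p, (ℓ, (r, k))) → ∃ (a : List ℤ) (m : ℕ) (z : List Bool), (a.length = ℓ - 1 ∧ (∑ j ∈ Finset.range (ℓ - 1), ((a.getD j 0 : ℤ) : ℂ) * Complex.exp (2 * Real.pi * Complex.I * (j : ℂ) / (ℓ : ℂ))) = (∑ x ∈ Finset.Icc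 1 (p - 1), ∑ j ∈ Finset.range ℓ, if r ^ j % p = x ^ ((p - 1) / ℓ) % p then Complex.exp (2 * Real.pi * Complex.I * ((j : ℂ) / (ℓ : ℂ) + (x : ℂ) / (p : ℂ))) else 0) ^ ℓ) ∧ m < 64 * ℓ ∧ |Complex.arg ((∑ x ∈ Finset.Icc 1 (p - 1), ∑ j ∈ Finset.range ℓ, if r ^ j % p = x ^ ((p - 1) / ℓ) % p then Complex.exp (2 * Real.pi * Complex.I * ((j : ℂ) / (ℓ : ℂ) + (x : ℂ) / (p : ℂ))) else 0) * Complex.exp (-(2 * Real.pi * Complex.I * (m : ℂ) / (64 * (ℓ : ℂ)))))| ≤ 2 * Real.pi / (64 * (ℓ : ℝ)) ∧ y = boolPair (Literature.Computability.Complexity.encodingIntBool.listBool.encode a) (boolPair (encodeNat m) z)} := by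
  sorry

/-- **stub_cut** (classical exact decision in `FP`: input validation by AKS + modexp, candidate selection
from the approximate angle, exact sign of `Im S^ℓ` at the cut; IrelandRosen1990 §8.3, Washington1997 Ch. 6;
L). -/
theorem stub_cut : ∀ C : ℕ, ∃ D : List Bool → List Bool, D ∈ FP ∧ (∀ u w : List Bool, (∀ p ℓ r k : ℕ, p.Prime ∧ ℓ.Prime ∧ Odd ℓ ∧ ℓ ∣ p - 1 ∧ ℓ ≤ Nat.log 2 p ^ C ∧ r < p ∧ r ^ ℓ % p = 1 ∧ r % p ≠ 1 ∧ k < ℓ → u ≠ (Computability.encodingNatBool.pairBool (Computability.encodingNatBool.pairBool (Computability.encodingNatBool.pairBool Computability.encodingNatBool))).encode (p, (ℓ, (r, k)))) → D (boolPair u w) = [false]) ∧ (∀ (p ℓ r k m : ℕ) (a : List ℤ) (z : List Bool), p.Prime ∧ ℓ.Prime ∧ Odd ℓ ∧ ℓ ∣ p - 1 ∧ ℓ ≤ Nat.log 2 p ^ C ∧ r < p ∧ r ^ ℓ % p = 1 ∧ r % p ≠ 1 ∧ k < ℓ → (a.length = ℓ - 1 ∧ (∑ j ∈ Finset.range (ℓ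 - 1), ((a.getD j 0 : ℤ) : ℂ) * Complex.exp (2 * Real.pi * Complex.I * (j : ℂ) / (ℓ : ℂ))) = (∑ x ∈ Finset.Icc 1 (p - 1), ∑ j ∈ Finset.range ℓ, if r ^ j % p = x ^ ((p - 1) / ℓ) % p then Complex.exp (2 * Real.pi * Complex.I * ((j : ℂ) / (ℓ : ℂ) + (x : ℂ) / (p : ℂ))) else 0) ^ ℓ) → m < 64 * ℓ → |Complex.arg ((∑ x ∈ Finset.Icc 1 (p - 1), ∑ j ∈ Finset.range ℓ, if r ^ j % p = x ^ ((p - 1) / ℓ) % p then Complex.exp (2 * Real.pi * Complex.I * ((j : ℂ) / (ℓ : ℂ) + (x : ℂ) / (p : ℂ))) else 0) * Complex.exp (-(2 * Real.pi * Complex.I * (m : ℂ) / (64 * (ℓ : ℂ)))))| ≤ 2 * Real.pi / (64 * (ℓ : ℝ)) → D (boolPair ((Computability.encodingNatBool.pairBool (Computability.encodingNatBool.pairBool (Computability.encodingNatBool.pairBool Computability.encodingNatBool))).encode (p, (ℓ, (r, k)))) (boolPair (Literature.Computability.Complexity.encodingIntBool.listBool.encode a) (boolPair (encodeNat m) z)))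 = [decide (Int.floor ((ℓ : ℝ) * (Complex.arg (∑ x ∈ Finset.Icc 1 (p - 1), ∑ j ∈ Finset.range ℓ, if r ^ j % p = x ^ ((p - 1) / ℓ) % p then Complex.exp (2 * Real.pi * Complex.I * ((j : ℂ) / (ℓ : ℂ) + (x : ℂ) / (p : ℂ))) else 0) + Real.pi) / (2 * Real.pi)) = (k : ℤ))]) := by
  sorry

/-! ### The composition (sorry-free) -/

open scoped Classical in
/-- **Decision from promise-free search + exact decoder** (Bernstein–Vazirani 1997 §8 pattern, generic in the
encoding and the target set): if a search problem `R` is `IsQSolvable` and an `FP` decoder `D` maps EVERY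
pair ⟨input, valid output⟩ to the indicator bit of `e.toLanguage S`, that language is in `BQP`. -/
theorem toLanguage_mem_BQP_of_search_decode {α : Type} (e : Encoding α Bool) {S : Set α}
    {R : List Bool → Set (List Bool)} {D : List Bool → List Bool} (hR : IsQSolvable R) (hD : D ∈ FP)
    (hval : ∀ u, ∀ y ∈ R u, D (boolPair u y) = [decide (u ∈ e.toLanguage S)]) :
    e.toLanguage S ∈ BQP := by
  have hW := isQSolvable_classicalWrap_holds id D (PolyTimeComputable.id _) hD hR
  refine mem_BQP_of_isQSolvable_bit (fun _ _ => QCircuit.outputPMF_apply_holds) cliffordT_isUnitary_holds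
    (L := e.toLanguage S) (bit := fun u => decide (u ∈ e.toLanguage S))
    (fun u => decide_eq_true_iff) ?_
  refine hW.mono fun u z hz => ?_
  obtain ⟨y, hy, hyz⟩ := hz
  rw [hval u y hy] at hyz
  exact hyz

open scoped Classical in
/-- **Composition of the birth line** (kernel-checked, no `sorry`): the three stub statements give the crux
`Theses.StickelbergerGrid.SectorMembershipOfGrid` BY NAME.  Pure logic over
`toLanguage_mem_BQP_of_search_decode`: the grid hypothesis of the crux and the point feed `stub_join`; the
decoder of `stub_cut` is correct on admissible inputs by (b) and off them by (a) (canonical codes). -/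
theorem SectorMembershipOfGrid_of (h₁ : Goal.stub_point) (h₂ : Goal.stub_join) (h₃ : Goal.stub_cut) :
    SectorMembershipOfGrid := by
  intro hG C
  obtain ⟨D, hDFP, hDoff, hDon⟩ := h₃ C
  have hJ := h₂ hG h₁ C
  refine toLanguage_mem_BQP_of_search_decode _ hJ hDFP fun u y hy => ?_
  by_cases hu : ∃ p ℓ r k : ℕ, (p.Prime ∧ ℓ.Prime ∧ Odd ℓ ∧ ℓ ∣ p - 1 ∧ ℓ ≤ Nat.log 2 p ^ C ∧ r < p ∧ r ^ ℓ % p = 1 ∧ r % p ≠ 1 ∧ k < ℓ) ∧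
      u = (Computability.encodingNatBool.pairBool (Computability.encodingNatBool.pairBool (Computability.encodingNatBool.pairBool Computability.encodingNatBool))).encode (p, (ℓ, (r, k)))
  · obtain ⟨p, ℓ, r, k, hadm, rfl⟩ := hu
    obtain ⟨a, m, z, hgrid, hm, hang, rfl⟩ := hy p ℓ r k hadm rfl
    rw [hDon p ℓ r k m a z hadm hgrid hm hang]
    refine congrArg (fun b => [b]) (decide_eq_decide.mpr ?_)
    refine Iff.trans ?_ (Computability.Encoding.mem_toLanguage_iff _ _ (p, (ℓ, (r, k)))).symm
    obtain ⟨hp, hl, hodd, hdvd, hle, hr, hpow, hne, hk⟩ := hadm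
    constructor
    · intro h
      exact ⟨p, ℓ, r, k, rfl, hp, hl, hodd, hdvd, hle, hr, hpow, hne, hk, h⟩
    · rintro ⟨p', ℓ', r', k', heq, -, -, -, -, -, -, -, -, -, h⟩
      obtain ⟨rfl, rfl, rfl, rfl⟩ : p = p' ∧ ℓ = ℓ' ∧ r = r' ∧ k = k' := by
        simpa only [Prod.mk.injEq] using heq
      exact h
  · -- off the promise the decoder answers `[false]`, and `u` is not in the language (codes are canonical)
    rw [hDoff u y fun p ℓ r k hadm hue => hu ⟨p, ℓ, r, k, hadm, hue⟩]
    refine congrArg (fun b => [b]) (decide_eq_false_iff_not.mpr ?_).symm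
    rintro ⟨t, ht, htu⟩
    obtain ⟨p, ℓ, r, k, rfl, hp, hl, hodd, hdvd, hle, hr, hpow, hne, hk, -⟩ := ht
    exact hu ⟨p, ℓ, r, k, ⟨hp, hl, hodd, hdvd, hle, hr, hpow, hne, hk⟩, htu.symm⟩

/-- The registered stubs feed the composition (checks that the inline stub statements are the `Goal.*` ones). -/
example : SectorMembershipOfGrid := SectorMembershipOfGrid_of stub_point stub_join stub_cut

end Summit.QuantumAdvantage.QuantumAdvantage.Cruxes.SectorMembershipOfGrid.Birth
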